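import Mathlib
import Summits.QuantumFields.YangMills.Theses.FlowLineStateSpace
import Summits.QuantumFields.YangMills.Theorems.FlowLineStateSpaceEntropyTorusGauss
import Literature.MathematicalPhysics.QuantumLattice.BoundedWilsonFlowLift
import Literature.MathematicalPhysics.QuantumLattice.TorusWilsonFlowContinuity
import Literature.MathematicalPhysics.QuantumFieldTheory.LatticeGaugeProofs
import Literature.MathematicalPhysics.QuantumFieldTheory.Sweep1AreaLawProofs

/-!
# `FlowLineStateSpace.EntropyNonConcentrationFromUI` (item stmt-QuantumFields-14707) — proof

The instance-wise reduction «uniform integrability ⇒ little-o over Markov» of route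
FlowLineStateSpace (YangMills sub-problem): if the physical flowed densities
`X = t₀² e_k(s t₀, 0)` are uniformly integrable on every window (the crux's conclusion for this
data), then for every `ε₀ > 0`, window `[t₁,t₂]` and `η > 0` there is `R₀ > 0` with
`μ_k{Φ^{lat}_{(x,s)}(R) ≥ ε₀} ≤ η R⁴` for `0 < R ≤ R₀`, eventually in `k`, all sites `x` and
`s ∈ [t₁,t₂]`, where `Φ^{lat} = Σ_y exp(-d(x,y)²/(4R²t₀)) e_k((s-R²)t₀, y)`.

Proof (the item's sketch, no physics): write `e = t₀⁻² X`, `X = X ∧ Λ⁺ + (X - Λ⁺)₊`; the Gaussian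
weight sum obeys `W ≤ C_W R⁴ t₀²` once `R² t₀ ≥ 1` (`C_W = 16(1+√π)⁴`, helper file
`FlowLineStateSpaceEntropyTorusGauss`); with `δ = η ε₀/(2 C_W)`, `Λ` from the UI hypothesis on the
window `[t₁/2, t₂]` and `R₀ = min(√(t₁/2), 1, ε₀/(2C_W(Λ⁺+1)))` the truncated part never reaches
`ε₀/2`, so `{Φ ≥ ε₀} ⊆ {t₀⁻² Σ_y w_y (X_y - Λ⁺)₊ ≥ ε₀/2}`; Markov and
`E_k (X_y - Λ⁺)₊ = E_k (X_0 - Λ⁺)₊ ≤ δ` — translation invariance of the torus Wilson measure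
(`wilsonMeasure_map_torusConfigShift`) and translation covariance of the flow line (uniqueness on
the finite torus: `flowedEnergy_eq_of_isWilsonFlowLine`, `boundedMatrixWilsonFlow_translate`) —
give `μ_k{Φ ≥ ε₀} ≤ (2/ε₀) C_W R⁴ δ = η R⁴`. Measurability from `continuous_flowedEnergy`.

Main theorem: `Summit.QuantumFields.YangMills.Theorems.entropyNonConcentrationFromUI_proof`.
Support item of a route whose cruxes are open; no crux, rung or summit is proved; the Yang–Mills
mass gap is NOT proved by this.
-/

noncomputable section

open MeasureTheory Filter Topology Finset
open Literature.MathematicalPhysics.QuantumFieldTheory Literature.MathematicalPhysics.QuantumLattice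

namespace Summit.QuantumFields.YangMills.Theorems

namespace FlowLineStateSpaceEntropy

section FlowA

variable {G : Type} [Group G] [TopologicalSpace G]

/-- The route's flowed density `e_k(τ, x, U) = 2 Σ_{i<j} (N - Re tr ρ(U_p(B_τ U)))` of a flow line
`B` IS the tree's `flowedEnergy ρ τ x U` (uniqueness of the Wilson flow on the finite torus). -/
theorem density_eq_flowedEnergy (r : LatticeRep G) {S : ℕ} [NeZero S] {U : GaugeConfig 4 S G}
    {B : ℝ → GaugeConfig 4 S G}
    (hB : IsWilsonFlowLine (Set.range r.ρ) (fun e => r.ρ (U e)) fun s e => r.ρ (B s e))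
    (τ : ℝ) (x : Site 4 S) :
    (2 * ∑ i : Fin 4, ∑ j : Fin 4,
        if i < j then ((r.N : ℝ) - (r.ρ (plaquetteHolonomy (B τ) x i j)).trace.re) else 0 : ℝ) =
      flowedEnergy r.ρ τ x U :=
  (flowedEnergy_eq_of_isWilsonFlowLine r.ρ r.mem_unitary hB τ x).symm

/-- The route's flowed density is between `0` and `64 N`. -/
theorem density_bounds (r : LatticeRep G) {S : ℕ} (V : GaugeConfig 4 S G) (x : Site 4 S) :
    0 ≤ (2 * ∑ i : Fin 4, ∑ j : Fin 4,
        if i < j then ((r.N : ℝ) - (r.ρ (plaquetteHolonomy V x i j)).trace.re) else 0 : ℝ) ∧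
    (2 * ∑ i : Fin 4, ∑ j : Fin 4,
        if i < j then ((r.N : ℝ) - (r.ρ (plaquetteHolonomy V x i j)).trace.re) else 0 : ℝ) ≤
      64 * r.N := by
  have hterm : ∀ i j : Fin 4, 0 ≤ (if i < j then ((r.N : ℝ) -
      (r.ρ (plaquetteHolonomy V x i j)).trace.re) else 0 : ℝ) ∧
      (if i < j then ((r.N : ℝ) - (r.ρ (plaquetteHolonomy V x i j)).trace.re) else 0 : ℝ) ≤
        2 * r.N := by
    intro i j
    have h := abs_le.mp
      (Literature.MathematicalPhysics.QuantumFieldTheory.abs_re_trace_le_of_mem_unitaryGroup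
        (r.mem_unitary (plaquetteHolonomy V x i j)))
    have hN : (0 : ℝ) ≤ r.N := Nat.cast_nonneg _
    split_ifs
    · constructor <;> linarith [h.1, h.2]
    · constructor <;> linarith
  constructor
  · exact mul_nonneg (by norm_num) (sum_nonneg fun i _ => sum_nonneg fun j _ => (hterm i j).1)
  · have : ∑ i : Fin 4, ∑ j : Fin 4, (if i < j then ((r.N : ℝ) -
        (r.ρ (plaquetteHolonomy V x i j)).trace.re) else 0 : ℝ) ≤
        ∑ _i : Fin 4, ∑ _j : Fin 4, (2 * (r.N : ℝ)) :=
      sum_le_sum fun i _ => sum_le_sum fun j _ => (hterm i j).2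
    simp only [sum_const, card_univ, Fintype.card_fin, nsmul_eq_mul, Nat.cast_ofNat] at this
    linarith

/-- Continuity of the flowed density in the configuration (for the Borel structures in play). -/
theorem continuous_density (r : LatticeRep G) {S : ℕ} [NeZero S] (t : ℝ) (x : Site 4 S) :
    Continuous fun U : GaugeConfig 4 S G => flowedEnergy r.ρ t x U :=
  continuous_flowedEnergy r.ρ r.continuous r.mem_unitary t x

end FlowA

section FlowB

variable {G : Type} [Group G] [MeasurableSpace G]

/-- **Translation covariance of the flowed density**: `E_t(y)(U) = E_t(0)(U(· + y))`, i.e.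
`flowedEnergy ρ t y U = flowedEnergy ρ t 0 (torusConfigShift (-y) U)` (uniqueness of the flow on
the finite torus, `boundedMatrixWilsonFlow_translate`, `energyDensity_comp`). -/
theorem flowedEnergy_translate {N : ℕ} (ρ : G →* Matrix (Fin N) (Fin N) ℂ) {S : ℕ} [NeZero S]
    (t : ℝ) (y : Site 4 S) (U : GaugeConfig 4 S G) :
    flowedEnergy ρ t y U = flowedEnergy ρ t 0 (torusConfigShift (-y) U) := by
  have hshift : (torusConfigShift (-y) U : GaugeConfig 4 S G) = U ∘ Prod.map (· + y) id := by
    funext ⟨x, μ⟩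
    rw [torusConfigShift_apply]
    simp [sub_neg_eq_add]
  rw [hshift, flowedEnergy_eq_energyDensity, flowedEnergy_eq_energyDensity]
  have hW : wilsonFlowMatrix ρ t (U ∘ Prod.map (· + y) id) =
      wilsonFlowMatrix ρ t U ∘ Prod.map (· + y) id := by
    unfold wilsonFlowMatrix
    rw [← boundedMatrixWilsonFlow_eq_matrixWilsonFlow, ← boundedMatrixWilsonFlow_eq_matrixWilsonFlow,
      ← boundedMatrixWilsonFlow_translate]
    rfl
  rw [hW, energyDensity_comp (isShiftCompatible_add_const y), zero_add]

end FlowB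

section FlowC

variable {G : Type} [Group G] [TopologicalSpace G] [IsTopologicalGroup G] [CompactSpace G]
  [MeasurableSpace G] [BorelSpace G]

/-- **Translation invariance of expectations of the flowed density**: for every function `F`,
`∫ F(E_t(y)(U)) dμ = ∫ F(E_t(0)(U)) dμ` under the torus Wilson measure. -/
theorem integral_comp_flowedEnergy_translate {N : ℕ} (ρ : G →* Matrix (Fin N) (Fin N) ℂ) {S : ℕ}
    [NeZero S] (β t : ℝ) (y : Site 4 S) (F : ℝ → ℝ) :
    ∫ U, F (flowedEnergy ρ t y U) ∂(wilsonMeasure (d := 4) (L := S) ρ β) =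
      ∫ U, F (flowedEnergy ρ t 0 U) ∂(wilsonMeasure (d := 4) (L := S) ρ β) := by
  simp_rw [flowedEnergy_translate ρ t y]
  rw [← integral_map_equiv (torusConfigShift (-y)) (fun U => F (flowedEnergy ρ t 0 U)),
    wilsonMeasure_map_torusConfigShift]

end FlowC

/-! ### Elementary inequalities -/

/-- Truncation: `X ≤ Λ⁺ + (X - Λ⁺)₊`. -/
theorem le_trunc_add_pos (X L : ℝ) : X ≤ L + max (X - L) 0 := by
  have := le_max_left (X - L) 0
  linarith

/-- Monotonicity of the positive part in the threshold: `Λ ≤ Λ'` gives `(X - Λ')₊ ≤ (X - Λ)₊`. -/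
theorem pos_part_anti {X L L' : ℝ} (h : L ≤ L') : max (X - L') 0 ≤ max (X - L) 0 :=
  max_le_max (by linarith) le_rfl

/-- `R⁴ ≤ R` for `0 ≤ R ≤ 1`. -/
theorem pow_four_le_self {R : ℝ} (h0 : 0 ≤ R) (h1 : R ≤ 1) : R ^ 4 ≤ R := by
  calc R ^ 4 ≤ R ^ 1 := pow_le_pow_of_le_one h0 h1 (by norm_num)
    _ = R := pow_one R

end FlowLineStateSpaceEntropy
set_option maxHeartbeats 400000 in
open FlowLineStateSpaceEntropy in
/-- **Item stmt-QuantumFields-14707 (`FlowLineStateSpace.EntropyNonConcentrationFromUI`).**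
Uniform integrability of the physical flowed densities on every window implies, for every
`ε₀ > 0`, window `[t₁,t₂]` and `η > 0`, an `R₀ > 0` with
`μ_k{Φ^{lat}_{(x,s)}(R) ≥ ε₀} ≤ η R⁴` for `0 < R ≤ R₀`, eventually in `k`, all `x` and
`s ∈ [t₁,t₂]` — truncation `X = X∧Λ⁺ + (X-Λ⁺)₊`, the torus Gaussian weight sum, Markov, and
translation invariance of the torus Wilson measure plus translation covariance of the flow. Support
item of route FlowLineStateSpace only; no crux, rung or summit is proved. -/
theorem entropyNonConcentrationFromUI_proof :
    Summit.QuantumFields.YangMills.Theses.FlowLineStateSpace.EntropyNonConcentrationFromUI := by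
  unfold Summit.QuantumFields.YangMills.Theses.FlowLineStateSpace.EntropyNonConcentrationFromUI
  intro G _ _ _ _ hG
  letI : MeasurableSpace G := borel G
  haveI : BorelSpace G := ⟨rfl⟩
  intro r β L B hB μ e t0 ht0 ht0lim hL hUI ε₀ hε₀ t₁ t₂ ht₁ ht₁₂ η hη
  haveI : SecondCountableTopology G :=
    (r.continuous.isClosedEmbedding r.injective).isEmbedding.secondCountableTopology
  -- constants
  set CW : ℝ := 16 * (1 + Real.sqrt Real.pi) ^ 4 with hCW
  have hCWpos : 0 < CW := by positivity
  set δ : ℝ := η * ε₀ / (2 * CW) with hδ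
  have hδpos : 0 < δ := by positivity
  obtain ⟨Λ, hΛ⟩ := hUI (t₁ / 2) t₂ (by positivity) (by linarith) δ hδpos
  set Λp : ℝ := max Λ 0 with hΛp
  have hΛp0 : 0 ≤ Λp := le_max_right _ _
  have hΛle : Λ ≤ Λp := le_max_left _ _
  set R₀ : ℝ := min (Real.sqrt (t₁ / 2)) (min 1 (ε₀ / (2 * CW * (Λp + 1)))) with hR₀
  have hR₀pos : 0 < R₀ :=
    lt_min (Real.sqrt_pos.mpr (by positivity)) (lt_min one_pos (by positivity))
  refine ⟨R₀, hR₀pos, fun R hR hRR₀ => ?_⟩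
  have hR1 : R ≤ 1 := hRR₀.trans ((min_le_right _ _).trans (min_le_left _ _))
  have hRε : R ≤ ε₀ / (2 * CW * (Λp + 1)) :=
    hRR₀.trans ((min_le_right _ _).trans (min_le_right _ _))
  have hRt : R ^ 2 ≤ t₁ / 2 := by
    have h1 : R ≤ Real.sqrt (t₁ / 2) := hRR₀.trans (min_le_left _ _)
    have h2 : R ^ 2 ≤ Real.sqrt (t₁ / 2) ^ 2 := pow_le_pow_left₀ hR.le h1 2
    rwa [Real.sq_sqrt (by positivity)] at h2
  have hR4 : R ^ 4 ≤ R := pow_four_le_self hR.le hR1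
  have htrunc : CW * Λp * R ^ 4 ≤ ε₀ / 2 := by
    calc CW * Λp * R ^ 4 ≤ CW * (Λp + 1) * R := by
          apply mul_le_mul _ hR4 (by positivity) (by positivity)
          nlinarith
      _ ≤ CW * (Λp + 1) * (ε₀ / (2 * CW * (Λp + 1))) := by gcongr
      _ = ε₀ / 2 := by field_simp
  -- eventually `R² t₀ ≥ 1`
  have hev : ∀ᶠ k in atTop, 1 / R ^ 2 ≤ t0 k := ht0lim.eventually_ge_atTop _
  filter_upwards [hev] with k hk
  intro x s hs
  have ht0pos : 0 < t0 k := ht0 k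
  have ht0sq : 0 < t0 k ^ 2 := by positivity
  have hσ : 1 ≤ R ^ 2 * t0 k := by
    rw [div_le_iff₀ (by positivity)] at hk; linarith
  set s' : ℝ := s - R ^ 2 with hs'
  have hs'mem : s' ∈ Set.Icc (t₁ / 2) t₂ :=
    ⟨by rw [hs']; linarith [hs.1], by rw [hs']; nlinarith [hs.2]⟩
  haveI : IsProbabilityMeasure (μ k) := isProbabilityMeasure_wilsonMeasure r.ρ r.continuous (β k)
  -- the density is the tree's flowed density
  have he : ∀ (τ : ℝ) (y : Site 4 (2 * L k + 1)) (U : GaugeConfig 4 (2 * L k + 1) G),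
      e k τ y U = flowedEnergy r.ρ τ y U := fun τ y U =>
    density_eq_flowedEnergy r (hB k U) τ y
  have he0 : ∀ (τ : ℝ) (y : Site 4 (2 * L k + 1)) (U : GaugeConfig 4 (2 * L k + 1) G),
      0 ≤ e k τ y U ∧ e k τ y U ≤ 64 * r.N := fun τ y U => density_bounds r (B k τ U) y
  have hcont : ∀ (τ : ℝ) (y : Site 4 (2 * L k + 1)),
      Continuous fun U : GaugeConfig 4 (2 * L k + 1) G => e k τ y U := by
    intro τ y
    have := continuous_density r (S := 2 * L k + 1) τ y
    refine this.congr fun U => (he τ y U).symm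
  -- the weights and their sum
  set τ : ℝ := s' * t0 k with hτ
  set w : Site 4 (2 * L k + 1) → ℝ := fun y =>
    Real.exp (-(∑ i : Fin 4, ((min (x i - y i).val (2 * L k + 1 - (x i - y i).val) : ℕ) : ℝ) ^ 2) /
      (4 * R ^ 2 * t0 k)) with hw
  have hw0 : ∀ y, 0 ≤ w y := fun y => (Real.exp_pos _).le
  have hW : ∑ y, w y ≤ CW * (R ^ 2 * t0 k) ^ 2 := by
    have h := gaussSum_torus_le_of_one_le hσ (2 * L k) x
    simp only [← mul_assoc] at h
    simpa [hw, hCW, ← mul_assoc] using h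
  -- truncated variables
  set Ψ : GaugeConfig 4 (2 * L k + 1) G → ℝ := fun U =>
    (t0 k ^ 2)⁻¹ * ∑ y, w y * max (t0 k ^ 2 * e k τ y U - Λp) 0 with hΨ
  have hΨnn : ∀ U, 0 ≤ Ψ U := fun U =>
    mul_nonneg (by positivity) (sum_nonneg fun y _ => mul_nonneg (hw0 y) (le_max_right _ _))
  -- (1) the inclusion `{Φ ≥ ε₀} ⊆ {Ψ ≥ ε₀/2}`
  have hincl : {U | ε₀ ≤ ∑ y, w y * e k ((s - R ^ 2) * t0 k) y U} ⊆ {U | ε₀ / 2 ≤ Ψ U} := by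
    intro U hU
    simp only [Set.mem_setOf_eq] at hU ⊢
    have hsum : ∑ y, w y * e k τ y U ≤ CW * Λp * R ^ 4 + Ψ U := by
      have h1 : ∀ y, w y * e k τ y U ≤
          (t0 k ^ 2)⁻¹ * (w y * Λp) + (t0 k ^ 2)⁻¹ * (w y * max (t0 k ^ 2 * e k τ y U - Λp) 0) := by
        intro y
        have := le_trunc_add_pos (t0 k ^ 2 * e k τ y U) Λp
        have hwy := hw0 y
        rw [← mul_add, ← mul_add]
        calc w y * e k τ y U = (t0 k ^ 2)⁻¹ * (w y * (t0 k ^ 2 * e k τ y U)) := by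
              field_simp
          _ ≤ (t0 k ^ 2)⁻¹ * (w y * (Λp + max (t0 k ^ 2 * e k τ y U - Λp) 0)) := by
              gcongr
      calc ∑ y, w y * e k τ y U
          ≤ ∑ y, ((t0 k ^ 2)⁻¹ * (w y * Λp) +
              (t0 k ^ 2)⁻¹ * (w y * max (t0 k ^ 2 * e k τ y U - Λp) 0)) := sum_le_sum fun y _ => h1 y
        _ = (t0 k ^ 2)⁻¹ * Λp * ∑ y, w y + Ψ U := by
              rw [sum_add_distrib]
              congr 1
              · rw [mul_sum]
                refine sum_congr rfl fun y _ => ?_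
                ring
              · simp only [hΨ, mul_sum]
        _ ≤ (t0 k ^ 2)⁻¹ * Λp * (CW * (R ^ 2 * t0 k) ^ 2) + Ψ U := by gcongr
        _ = CW * Λp * R ^ 4 + Ψ U := by field_simp
    have hτs : (s - R ^ 2) * t0 k = τ := by rw [hτ, hs']
    rw [hτs] at hU
    linarith
  -- (2) integrability of `Ψ`
  have hmeas : ∀ y, Continuous fun U : GaugeConfig 4 (2 * L k + 1) G =>
      max (t0 k ^ 2 * e k τ y U - Λp) 0 := fun y =>
    ((continuous_const.mul (hcont τ y)).sub continuous_const).max continuous_const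
  have hbdd : ∀ y (U : GaugeConfig 4 (2 * L k + 1) G),
      ‖max (t0 k ^ 2 * e k τ y U - Λp) 0‖ ≤ t0 k ^ 2 * (64 * r.N) := by
    intro y U
    obtain ⟨h0, h64⟩ := he0 τ y U
    rw [Real.norm_of_nonneg (le_max_right _ _)]
    refine max_le ?_ (by positivity)
    nlinarith
  have hint : ∀ y, Integrable (fun U : GaugeConfig 4 (2 * L k + 1) G =>
      max (t0 k ^ 2 * e k τ y U - Λp) 0) (μ k) := fun y =>
    Integrable.of_bound (hmeas y).aestronglyMeasurable _ (ae_of_all _ (hbdd y))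
  have hΨint : Integrable Ψ (μ k) := by
    refine Integrable.const_mul (integrable_finsetSum _ fun y _ => (hint y).const_mul (w y)) _
  -- (3) `∫ Ψ ≤ CW R⁴ δ`
  have hterm : ∀ y, ∫ U, max (t0 k ^ 2 * e k τ y U - Λp) 0 ∂μ k ≤ δ := by
    intro y
    have htr : ∫ U, max (t0 k ^ 2 * e k τ y U - Λp) 0 ∂μ k =
        ∫ U, max (t0 k ^ 2 * e k τ 0 U - Λp) 0 ∂μ k := by
      have h := integral_comp_flowedEnergy_translate r.ρ (β k) τ y (fun v => max (t0 k ^ 2 * v - Λp) 0)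
      simp only [← he] at h
      exact h
    rw [htr]
    calc ∫ U, max (t0 k ^ 2 * e k τ 0 U - Λp) 0 ∂μ k
        ≤ ∫ U, max (t0 k ^ 2 * e k τ 0 U - Λ) 0 ∂μ k := by
          refine integral_mono (hint 0) ?_ fun U => pos_part_anti hΛle
          exact Integrable.of_bound
            (((continuous_const.mul (hcont τ 0)).sub continuous_const).max
              continuous_const).aestronglyMeasurable (t0 k ^ 2 * (64 * r.N) + |Λ|)
            (ae_of_all _ fun U => by
              obtain ⟨h0, h64⟩ := he0 τ 0 U
              rw [Real.norm_of_nonneg (le_max_right _ _)]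
              refine max_le ?_ (by positivity)
              nlinarith [neg_abs_le Λ])
      _ ≤ δ := hΛ k s' hs'mem
  have hintΨ : ∫ U, Ψ U ∂μ k ≤ CW * R ^ 4 * δ := by
    have hI : ∫ U, Ψ U ∂μ k =
        (t0 k ^ 2)⁻¹ * ∑ y, w y * ∫ U, max (t0 k ^ 2 * e k τ y U - Λp) 0 ∂μ k := by
      rw [hΨ, integral_const_mul, integral_finsetSum _ fun y _ => (hint y).const_mul (w y)]
      congr 1
      refine sum_congr rfl fun y _ => ?_
      rw [integral_const_mul]
    rw [hI]
    calc (t0 k ^ 2)⁻¹ * ∑ y, w y * ∫ U, max (t0 k ^ 2 * e k τ y U - Λp) 0 ∂μ k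
        ≤ (t0 k ^ 2)⁻¹ * ∑ y, w y * δ := by
          gcongr with y hy
          exact hterm y
      _ = (t0 k ^ 2)⁻¹ * δ * ∑ y, w y := by rw [← sum_mul]; ring
      _ ≤ (t0 k ^ 2)⁻¹ * δ * (CW * (R ^ 2 * t0 k) ^ 2) := by gcongr
      _ = CW * R ^ 4 * δ := by field_simp
  -- (4) Markov and the conclusion
  have hmarkov := mul_meas_ge_le_integral_of_nonneg (ae_of_all _ hΨnn) hΨint (ε₀ / 2)
  have hfin : (μ k).real {U | ε₀ / 2 ≤ Ψ U} ≤ 2 / ε₀ * (CW * R ^ 4 * δ) := by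
    rw [div_mul_eq_mul_div, le_div_iff₀ hε₀]
    nlinarith [hmarkov, hintΨ, measureReal_nonneg (μ := μ k) (s := {U | ε₀ / 2 ≤ Ψ U})]
  calc (μ k).real {U | ε₀ ≤ ∑ y, w y * e k ((s - R ^ 2) * t0 k) y U}
      ≤ (μ k).real {U | ε₀ / 2 ≤ Ψ U} := measureReal_mono hincl
    _ ≤ 2 / ε₀ * (CW * R ^ 4 * δ) := hfin
    _ = η * R ^ 4 := by rw [hδ]; field_simp

end Summit.QuantumFields.YangMills.Theorems

end
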